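import Summits.QuantumFields.GaugeBoot.TiltedBoxTwoDimMidBlocks
import Summits.QuantumFields.GaugeBoot.SlabKernelAnnulus
import HarnessLib

/-!
# The two annuli of the link mirror of the even square box in two dimensions (gauge-boot, L3 supplement: 2D slab gluing, even side 2/3)

HONEST FRAMING (cell `pub-gaugeboot`, page 1 of every file): the venture produces certified bounds
on lattice expectations at stated coupling, gauge group, dimension and torus size; NOT a mass gap,
NOT a continuum limit, NOT a string tension; NOT Yang–Mills-summit-bearing (barriers
`FixedCouplingUltralocality`, `PerturbativeInvisibility`). Bookkeeping for the POSITIVE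
two-dimensional result `TiltedBoxEvenMidAxisRPTwoDim.lean`; it discharges nothing else.

The data of `SlabKernel.integral_mul_annulus` for the slab above ANY layer of a square box
`ℤ^d/Γ(M, M, L)` in two dimensions, based at a site `y` of that layer: rungs `rungAt y t = (y + t e_j, i)`,
lower letters `loAt y t U = U(y + t e_j, j)`, upper letters `upAt y t U = U(y + t e_j + e_i, j)`
(`2M`-periodic, rungs distinct, letters blind to every rung); the slab factor of the Boltzmann weight is
the annulus product `e^{-β ∑_{slab}(N - Re tr ρ)} = e^{-βN·2M} ∏_{t<2M} ω_β(a_t V_{t+1} b_t⁻¹ V_t⁻¹)`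
(`exp_slabSq_eq`). For the LINK mirror `θ : x_i ↦ 1 - x_i` of the even box `M = 2P`:
* the lower slab (layers `0 | 1`) is EXACT: `upAt 0 t (Θ U) = loAt 0 t U` (`upAt_zero_configMidReflect`),
  so the reflected upper word IS the lower word (`oprod_upAt_zero_configMidReflect`);
* the upper slab (layers `P | P+1`) is TWISTED: `loAt y₀ t (Θ U) = upAt y₀ (t + M) U`, so the upper word
  is a conjugate of the reflected lower word (`oprod_upAt_eq_conj`), as on the odd box.

References: A. A. Migdal, Sov. Phys. JETP 42 (1975) 413; K. Osterwalder, E. Seiler, Ann. Phys. 110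
(1978) 440, §2.
-/

noncomputable section

open MeasureTheory Complex Function
open Literature.RepresentationTheory.CompactGroups

namespace Summit.QuantumFields.GaugeBoot

namespace TiltedRP

namespace TwoDim

variable {d : ℕ} {i j : Fin d} {L M N : ℕ}
variable {G : Type*} [Group G] [TopologicalSpace G] [IsTopologicalGroup G] [CompactSpace G]
variable (ρ : G →* Matrix (Fin N) (Fin N) ℂ)

/-! ## Rungs and letters of the annulus through `y` (any square side) -/

/-- The rungs of the annulus through `y`: the `i`-links `(y + t e_j, i)`. -/
def rungAt (y : TiltedSite d i j M M L) (t : ℕ) : Link (TiltedSite d i j M M L) d := (cyc y t, i)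

/-- The lower letters `a_t(U) = U(y + t e_j, j)`. -/
def loAt (y : TiltedSite d i j M M L) (t : ℕ) (U : Config (TiltedSite d i j M M L) d G) : G := U (cyc y t, j)

/-- The upper letters `b_t(U) = U(y + t e_j + e_i, j)`. -/
def upAt (y : TiltedSite d i j M M L) (t : ℕ) (U : Config (TiltedSite d i j M M L) d G) : G :=
  U (cyc y t + tiltedUnit d i j M M L i, j)

omit [TopologicalSpace G] [IsTopologicalGroup G] [CompactSpace G] in
/-- The rungs are `2M`-periodic. [folklore] -/
theorem rungAt_add_two_mul (hij : i ≠ j) (y : TiltedSite d i j M M L) (t : ℕ) :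
    rungAt y (t + 2 * M) = rungAt y t := by
  simp only [rungAt, cyc_add_two_mul hij]

omit [TopologicalSpace G] [IsTopologicalGroup G] [CompactSpace G] in
/-- The rungs `r 0, …, r (2M-1)` are distinct. [folklore] -/
theorem rungAt_inj (hij : i ≠ j) (y : TiltedSite d i j M M L) (s t : ℕ) (hs : s < 2 * M) (ht : t < 2 * M)
    (h : rungAt y s = rungAt y t) : s = t :=
  cyc_inj hij _ hs ht (congrArg Prod.fst h)

omit [Group G] [TopologicalSpace G] [IsTopologicalGroup G] [CompactSpace G] in
/-- The lower letters do not see any rung. [folklore] -/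
theorem loAt_update [DecidableEq (TiltedSite d i j M M L)] (hij : i ≠ j) (y y' : TiltedSite d i j M M L) (t s : ℕ)
    (U : Config (TiltedSite d i j M M L) d G) (z : G) : loAt y t (update U (rungAt y' s) z) = loAt y t U := by
  unfold loAt rungAt
  rw [update_of_ne]
  exact fun h => hij (congrArg Prod.snd h).symm

omit [Group G] [TopologicalSpace G] [IsTopologicalGroup G] [CompactSpace G] in
/-- The upper letters do not see any rung. [folklore] -/
theorem upAt_update [DecidableEq (TiltedSite d i j M M L)] (hij : i ≠ j) (y y' : TiltedSite d i j M M L) (t s : ℕ)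
    (U : Config (TiltedSite d i j M M L) d G) (z : G) : upAt y t (update U (rungAt y' s) z) = upAt y t U := by
  unfold upAt rungAt
  rw [update_of_ne]
  exact fun h => hij (congrArg Prod.snd h).symm

omit [Group G] [TopologicalSpace G] [IsTopologicalGroup G] [CompactSpace G] in
/-- The upper letters are `2M`-periodic. [folklore] -/
theorem upAt_add_two_mul (hij : i ≠ j) (y : TiltedSite d i j M M L) (t : ℕ) (U : Config (TiltedSite d i j M M L) d G) :
    upAt y (t + 2 * M) U = upAt y t U := by
  simp only [upAt, cyc_add_two_mul hij]

/-! ## The slab factor of any layer is an annulus product -/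

omit [CompactSpace G] in
/-- The plaquette weight of the `t`-th plaquette of the annulus through `y` is
`ω_β(a_t V_{t+1} b_t⁻¹ V_t⁻¹)`. [folklore] -/
theorem exp_plaqObs_cyc [CompactSpace G] (hij : i ≠ j) (hρ : Continuous ρ) (β : ℝ) (y : TiltedSite d i j M M L) (t : ℕ)
    (U : Config (TiltedSite d i j M M L) d G) :
    (Real.exp (β * plaqObs ρ (tiltedUnit d i j M M L) (cyc y t, dp hij) U) : ℂ) =
      SlabKernel.plaqWt (SlabKernel.wilsonWt ρ β) (rungAt y) (loAt y) (upAt y) t U := by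
  unfold SlabKernel.plaqWt SlabKernel.wilsonWt plaqObs loAt upAt rungAt
  congr 3
  unfold dp mkDirPair
  by_cases h : i < j
  · rw [dif_pos h]
    simp only [holonomy, cyc_succ]
    rw [← CompactGroup.re_trace_map_inv ρ hρ]
    congr 3
    group
  · rw [dif_neg h]
    simp only [holonomy, cyc_succ]

open scoped Classical in
/-- **The slab factor through `y`**: `e^{-β ∑_{slab(x_i y)} (N - Re tr ρ(U_p))} = e^{-βN·2M} ∏_{t<2M} plaqWt_t(U)`
(square box of any side `M`, two dimensions). [folklore] -/
theorem exp_slabSq_eq [NeZero M] [NeZero L] (hij : i ≠ j) (hd : ∀ k : Fin d, k = i ∨ k = j) (hρ : Continuous ρ)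
    (β : ℝ) (y : TiltedSite d i j M M L) (U : Config (TiltedSite d i j M M L) d G) :
    (Real.exp (-β * ∑ p ∈ Finset.univ.filter (SquareSlab.IsSlabPlaq (axisCoord d L M y)),
        ((N : ℝ) - plaqObs ρ (tiltedUnit d i j M M L) p U)) : ℂ) =
      (Real.exp (-β * N * (2 * M)) : ℂ) *
        ∏ t ∈ Finset.range (2 * M), SlabKernel.plaqWt (SlabKernel.wilsonWt ρ β) (rungAt y) (loAt y) (upAt y) t U := by
  rw [filter_isSlabPlaqSq_eq_image hij hd y, Finset.sum_image (cycAnnulus_injOn hij y)]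
  simp_rw [← exp_plaqObs_cyc ρ hij hρ β y]
  rw [← Complex.ofReal_prod, ← Complex.ofReal_mul, ← Real.exp_sum, ← Real.exp_add]
  congr 1
  rw [Finset.sum_sub_distrib, Finset.sum_const, Finset.card_range, nsmul_eq_mul, ← Finset.mul_sum]
  push_cast
  ring_nf

/-! ## The link mirror of the even box on the two annuli -/

section EvenBox

variable {P : ℕ}

omit [TopologicalSpace G] [IsTopologicalGroup G] [CompactSpace G] in
/-- **The lower slab is exact**: `b_t(Θ U) = a_t(U)` for the annulus through `0` (`θ(y + e_i) = σ y = y`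
on the layer `0`). [folklore] -/
theorem upAt_zero_configMidReflect (hij : i ≠ j) (t : ℕ) (U : Config (TiltedSite d i j (2 * P) (2 * P) L) d G) :
    upAt (0 : TiltedSite d i j (2 * P) (2 * P) L) t
        (configMidReflect (tiltedUnit d i j (2 * P) (2 * P) L) i (tiltedAxisFlip d L (2 * P) hij) U) =
      loAt (0 : TiltedSite d i j (2 * P) (2 * P) L) t U := by
  unfold upAt loAt
  rw [configMidReflect_other _ i _ U _ (Ne.symm hij), (isAxisFlip_tiltedAxisFlip d L (2 * P) hij).midReflect_add_self,
    tiltedAxisFlip_eq_self_of_axisCoord_eq_zero d L (2 * P) hij _ (by rw [axisCoord_cyc hij, map_zero])]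

omit [TopologicalSpace G] [IsTopologicalGroup G] [CompactSpace G] in
/-- The reflected upper word of the lower annulus IS the lower word. [folklore] -/
theorem oprod_upAt_zero_configMidReflect (hij : i ≠ j) (n : ℕ) (U : Config (TiltedSite d i j (2 * P) (2 * P) L) d G) :
    SlabKernel.oprod (upAt (0 : TiltedSite d i j (2 * P) (2 * P) L)) n
        (configMidReflect (tiltedUnit d i j (2 * P) (2 * P) L) i (tiltedAxisFlip d L (2 * P) hij) U) =
      SlabKernel.oprod (loAt (0 : TiltedSite d i j (2 * P) (2 * P) L)) n U := by
  unfold SlabKernel.oprod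
  congr 1
  exact List.map_congr_left fun t _ => upAt_zero_configMidReflect hij t U

omit [TopologicalSpace G] [IsTopologicalGroup G] [CompactSpace G] in
/-- **The upper slab is twisted**: `a_t(Θ U) = b_{t+M}(U)` for the annulus through `y₀ = [P e_i]`
(`θ y = y + T + e_i` on the layer `P`). [folklore] -/
theorem loAt_layerSite_configMidReflect (hij : i ≠ j) (t : ℕ) (U : Config (TiltedSite d i j (2 * P) (2 * P) L) d G) :
    loAt (layerSite d L P : TiltedSite d i j (2 * P) (2 * P) L) t
        (configMidReflect (tiltedUnit d i j (2 * P) (2 * P) L) i (tiltedAxisFlip d L (2 * P) hij) U) =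
      upAt (layerSite d L P : TiltedSite d i j (2 * P) (2 * P) L) (t + 2 * P) U := by
  unfold loAt upAt
  rw [configMidReflect_other _ i _ U _ (Ne.symm hij),
    midReflect_of_axisCoord_eq_half d L P hij _ (by rw [axisCoord_cyc hij, axisCoord_layerSite]), cyc_add_tiltedTwist]

omit [TopologicalSpace G] [IsTopologicalGroup G] [CompactSpace G] in
/-- **The twist is a conjugation of the upper word**: `∏ b_t(U) = c · (∏ a_t(Θ U)) · c⁻¹`,
`c = b_0 ⋯ b_{M-1}`, `M = 2P`. [folklore] -/
theorem oprod_upAt_eq_conj (hij : i ≠ j) (U : Config (TiltedSite d i j (2 * P) (2 * P) L) d G) :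
    SlabKernel.oprod (upAt (layerSite d L P : TiltedSite d i j (2 * P) (2 * P) L)) (2 * (2 * P)) U =
      SlabKernel.oprod (upAt (layerSite d L P : TiltedSite d i j (2 * P) (2 * P) L)) (2 * P) U *
        SlabKernel.oprod (loAt (layerSite d L P : TiltedSite d i j (2 * P) (2 * P) L)) (2 * (2 * P))
          (configMidReflect (tiltedUnit d i j (2 * P) (2 * P) L) i (tiltedAxisFlip d L (2 * P) hij) U) *
        (SlabKernel.oprod (upAt (layerSite d L P : TiltedSite d i j (2 * P) (2 * P) L)) (2 * P) U)⁻¹ := by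
  have hΘ : SlabKernel.oprod (loAt (layerSite d L P : TiltedSite d i j (2 * P) (2 * P) L)) (2 * (2 * P))
      (configMidReflect (tiltedUnit d i j (2 * P) (2 * P) L) i (tiltedAxisFlip d L (2 * P) hij) U) =
      SlabKernel.oprod (fun t => upAt (layerSite d L P : TiltedSite d i j (2 * P) (2 * P) L) ((2 * P) + t))
        (2 * (2 * P)) U := by
    unfold SlabKernel.oprod
    congr 1
    refine List.map_congr_left fun t _ => ?_
    rw [loAt_layerSite_configMidReflect hij, add_comm]
  rw [hΘ, show 2 * (2 * P) = (2 * P) + (2 * P) from two_mul _,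
    SlabKernel.oprod_add (upAt (layerSite d L P : TiltedSite d i j (2 * P) (2 * P) L)) (2 * P) (2 * P) U,
    SlabKernel.oprod_add (fun t => upAt (layerSite d L P : TiltedSite d i j (2 * P) (2 * P) L) ((2 * P) + t))
      (2 * P) (2 * P) U]
  have hper : SlabKernel.oprod (fun t => upAt (layerSite d L P : TiltedSite d i j (2 * P) (2 * P) L)
      ((2 * P) + ((2 * P) + t))) (2 * P) U =
      SlabKernel.oprod (upAt (layerSite d L P : TiltedSite d i j (2 * P) (2 * P) L)) (2 * P) U := by
    unfold SlabKernel.oprod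
    congr 1
    refine List.map_congr_left fun t _ => ?_
    show upAt (layerSite d L P) ((2 * P) + ((2 * P) + t)) U = upAt (layerSite d L P) t U
    rw [← add_assoc, ← two_mul, add_comm, upAt_add_two_mul hij]
  rw [hper]
  group

end EvenBox

end TwoDim

end TiltedRP

end Summit.QuantumFields.GaugeBoot

end
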